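import Literature.NumberTheory.NumberFields.CyclicQuinticField2651K2ClassGroup
import Mathlib.NumberTheory.NumberField.Units.DirichletTheorem
import Mathlib.FieldTheory.Finite.Basic
import Mathlib.NumberTheory.NumberField.InfinitePlace.TotallyRealComplex
import HarnessLib

/-!
# The cyclic quintic field of conductor `2651`, number `2`: units modulo squares

For `K = CyclicQuintic2651K2.K` (`𝓞 K ≅ R = TAlg spec ℤ`, `Gal = ⟨σ⟩`): the unit
`v = [-2317, -2556, -2344, -2296, -2357]` (coordinates on the orbit sums; `N v = -1`), its conjugates
`unitv i = σⁱ v`, the `32` representatives `rep n = (-1)^{b₄} ∏_{i<4} (σⁱv)^{bᵢ}`, and the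
**`2`-adic class `tsig u = (u mod 4)³¹ ∈ (𝓞 K/4)ˣ`** (the group `(𝓞 K/4)ˣ ≅ (ℤ/2)⁵ × ℤ/31` has
exponent `62`, so `tsig` kills squares): the `32` classes `tsig (rep n)` are pairwise distinct
(kernel), hence by Dirichlet's theorem (`|𝓞ˣ/𝓞ˣ²| ≤ 32`) **every unit is `rep n · η²`**
(`exists_eq_rep_mul_sq`) and a unit with `tsig = 1` is a square. Pattern of the tree's
`CyclicQuinticField241Units.lean` (there with `2` split and residues modulo `8`); here `2` is inert.
Everything is PROVED; the real signs of the units are treated in the descent file.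

## References

* D. A. Marcus, *Number Fields*, 2nd ed. (2018), Ch. 5, Thm. 38 (Dirichlet). [folklore]
* J. H. Silverman, *The Arithmetic of Elliptic Curves*, 2nd ed., GTM 106 (2009), §X.1. [folklore]
* T. Dokchitser, V. Dokchitser, J. Number Theory 131 (2011) 1833–1839, proof of Thm. 2. [DokchitserDokchitser2011RankModN]
-/

noncomputable section

open NumberField

namespace Literature.NumberTheory.NumberFields

namespace CyclicQuintic2651K2

/-! ### `σ` on `𝓞 K` -/

/-- **`σ` restricted to `𝓞 K`** (a ring automorphism). [folklore] -/
def σint : 𝓞 K ≃+* 𝓞 K := RingOfIntegers.mapRingEquiv σ.toRingEquiv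

/-- `σint` is `σ` on `K`. [folklore] -/
@[simp] theorem coe_σint (a : 𝓞 K) : ((σint a : 𝓞 K) : K) = σ (a : K) := rfl

/-- `σint ∘ liftO = liftO ∘ shift`. [folklore] -/
theorem σint_liftO (y : R) : σint (liftO y) = liftO (shift y) := by
  apply RingOfIntegers.ext
  rw [coe_σint, coe_liftO, coe_liftO, liftK_shift]

/-- Iterates: `σⁿ (liftO y) = liftO (shiftⁿ y)`. [folklore] -/
theorem σint_iterate_liftO (n : ℕ) (y : R) : σint^[n] (liftO y) = liftO (shift^[n] y) := by
  induction n generalizing y with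
  | zero => rfl
  | succ n ih => rw [Function.iterate_succ_apply, Function.iterate_succ_apply, σint_liftO, ih]

/-- `σint` iterated is `σ` iterated, on `K`. [folklore] -/
theorem coe_σint_iterate (n : ℕ) (a : 𝓞 K) : ((σint^[n] a : 𝓞 K) : K) = σ^[n] (a : K) := by
  induction n generalizing a with
  | zero => rfl
  | succ n ih => rw [Function.iterate_succ_apply, Function.iterate_succ_apply, ih, coe_σint]

/-! ### The quotient `𝓞 K/4` and its unit group of exponent `62` -/

/-- The reduction `𝓞 K → R/4R = TAlg spec (ℤ/4)` (via `integerEquiv`). [folklore] -/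
def red4 : 𝓞 K →+* TAlg spec (ZMod 4) := (red 4).comp integerEquiv.symm.toRingHom

/-- `red4 (liftO y) = red 4 y`. [folklore] -/
theorem red4_liftO (y : R) : red4 (liftO y) = red 4 y := by
  show red 4 (integerEquiv.symm (integerEquiv y)) = red 4 y
  rw [RingEquiv.symm_apply_apply]

/-- The reduction `R/4R → R/2R`. [folklore] -/
def red42 : TAlg spec (ZMod 4) →+* TAlg spec (ZMod 2) := TAlg.map (ZMod.castHom (by norm_num : 2 ∣ 4) (ZMod 2))

/-- `R/2R = 𝔽₃₂` has `32` elements. [folklore] -/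
theorem card_mod_two : Fintype.card (TAlg spec (ZMod 2)) = 32 := by
  rw [Fintype.card_congr (⟨fun u => u.coef, fun f => ⟨f⟩, fun _ => rfl, fun _ => rfl⟩ : TAlg spec (ZMod 2) ≃ (Fin 5 → ZMod 2)),
    Fintype.card_fun, ZMod.card, Fintype.card_fin]
  norm_num

/-- In the field `R/2R` of `32` elements, `x³¹ = 1` for `x ≠ 0`. [folklore] -/
theorem pow_31_eq_one_mod_two {x : TAlg spec (ZMod 2)} (hx : x ≠ 0) : x ^ 31 = 1 := by
  letI := isField_mod_two.toField
  have h := FiniteField.pow_card_sub_one_eq_one x hx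
  rwa [card_mod_two] at h

/-- The kernel of `R/4R → R/2R` is `2 · (R/4R)`. [folklore] -/
theorem exists_eq_two_mul_of_red42_eq_zero {y : TAlg spec (ZMod 4)} (h : red42 y = 0) :
    ∃ z : TAlg spec (ZMod 4), y = 2 * z := by
  have hc : ∀ a, ∃ c : ZMod 4, y.coef a = 2 * c := fun a => by
    have ha := congrArg (fun u : TAlg spec (ZMod 2) => u.coef a) h
    simp only [red42, TAlg.map_coef, TAlg.zero_coef, ZMod.castHom_apply] at ha
    generalize y.coef a = t at ha ⊢
    revert t; decide
  choose c hc' using hc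
  refine ⟨⟨c⟩, ?_⟩
  ext a
  rw [hc' a]
  exact (TAlg.const_mul_coef' (2 : ZMod 4) ⟨c⟩ a).symm

/-- `4 = 0` in `R/4R`. [folklore] -/
theorem four_eq_zero' : (4 : TAlg spec (ZMod 4)) = 0 := by
  decide +kernel

/-- **`(𝓞 K/4)ˣ` has exponent `62`**: for a unit `w` of `R/4R`, `w̄³¹ = 1` in the field `R/2R`, so
`w³¹ = 1 + 2z` and `w⁶² = (1 + 2z)² = 1`. [folklore] -/
theorem pow_62_eq_one {w : TAlg spec (ZMod 4)} (hw : IsUnit w) : w ^ 62 = 1 := by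
  have h1 : red42 w ≠ 0 := fun h0 => by
    have := (hw.map red42)
    rw [h0, isUnit_zero_iff] at this
    have := congrArg (fun u : TAlg spec (ZMod 2) => u.coef 0) this
    simp [spec] at this
  have h2 : red42 (w ^ 31 - 1) = 0 := by rw [map_sub, map_pow, map_one, pow_31_eq_one_mod_two h1, sub_self]
  obtain ⟨z, hz⟩ := exists_eq_two_mul_of_red42_eq_zero h2
  have h3 : w ^ 31 = 1 + 2 * z := by rw [← hz]; ring
  calc w ^ 62 = (w ^ 31) ^ 2 := by rw [← pow_mul]
    _ = 1 + 4 * (z + z ^ 2) := by rw [h3]; ring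
    _ = 1 := by rw [four_eq_zero', zero_mul, add_zero]

/-! ### The unit `v`, its conjugates, the representatives -/

/-- `v = [-2317, -2556, -2344, -2296, -2357]` on the orbit sums (a unit of norm `-1`). [folklore] -/
def vP : R := ⟨![-2317, -2556, -2344, -2296, -2357]⟩

/-- `v⁻¹` (`±` the product of the other four conjugates). [folklore] -/
def vinvP : R := ⟨![14579, 13395, 13111, 13453, 13230]⟩

/-- `v · v⁻¹ = 1` (kernel identity). [folklore] -/
theorem vP_mul_vinvP : vP * vinvP = 1 := by
  decide +kernel

/-- `N(v) = -1` (kernel computation of the norm form). [folklore] -/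
theorem normT_vP : normT vP = ((-1 : ℤ) : R) := by
  decide +kernel

/-- **The unit `v ∈ (𝓞 K)ˣ`.** [folklore] -/
def unitv0 : (𝓞 K)ˣ :=
  Units.mkOfMulEqOne (liftO vP) (liftO vinvP) (by rw [← map_mul, vP_mul_vinvP, map_one])

/-- `σ` on units of `𝓞 K`. [folklore] -/
def σunit : (𝓞 K)ˣ →* (𝓞 K)ˣ := Units.map σint.toRingHom.toMonoidHom

/-- **The conjugate units `unitv i = σⁱ v`**, `i < 5`. [folklore] -/
def unitv (i : Fin 5) : (𝓞 K)ˣ := σunit^[i] unitv0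

/-- `unitv i = liftO (shiftⁱ v)` in `𝓞 K`. [folklore] -/
theorem coe_unitv (i : Fin 5) : ((unitv i : (𝓞 K)ˣ) : 𝓞 K) = liftO (shift^[(i : ℕ)] vP) := by
  rw [unitv, ← σint_iterate_liftO]
  generalize (i : ℕ) = n
  induction n with
  | zero => rfl
  | succ n ih => rw [Function.iterate_succ_apply', Function.iterate_succ_apply', ← ih]; rfl

/-- The `i`-th binary digit of `n < 32`. [folklore] -/
def bit (n : Fin 32) (i : Fin 5) : ℕ := (n : ℕ) / 2 ^ (i : ℕ) % 2

/-- **The `32` representatives** `rep n = (-1)^{b₄} ∏_{i<4} (σⁱ v)^{bᵢ}`, `b = bits of n`. [folklore] -/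
def rep (n : Fin 32) : (𝓞 K)ˣ :=
  (-1) ^ bit n 4 * ∏ i : Fin 4, unitv (Fin.castSucc i) ^ bit n (Fin.castSucc i)

/-- `rep 0 = 1`. [folklore] -/
theorem rep_zero : rep 0 = 1 := by
  simp [rep, bit]

/-! ### The `2`-adic class `tsig u = (u mod 4)³¹` -/

/-- **The `2`-adic class of a unit**: `(u mod 4)³¹ ∈ (𝓞 K/4)ˣ` (trivial on squares). [folklore] -/
def tsig (u : (𝓞 K)ˣ) : TAlg spec (ZMod 4) := red4 (u : 𝓞 K) ^ 31

/-- `tsig` is multiplicative. [folklore] -/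
theorem tsig_mul (u w : (𝓞 K)ˣ) : tsig (u * w) = tsig u * tsig w := by
  simp only [tsig, Units.val_mul, map_mul, mul_pow]

/-- `tsig 1 = 1`. [folklore] -/
theorem tsig_one : tsig 1 = 1 := by
  simp [tsig]

/-- `tsig` as a monoid homomorphism. [folklore] -/
def tsigHom : (𝓞 K)ˣ →* TAlg spec (ZMod 4) where
  toFun := tsig
  map_one' := tsig_one
  map_mul' := tsig_mul

/-- `tsigHom` is `tsig`. [folklore] -/
@[simp] theorem tsigHom_apply (u : (𝓞 K)ˣ) : tsigHom u = tsig u := rfl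

/-- **Squares of units have trivial class**: `tsig (η²) = (η mod 4)⁶² = 1`. [folklore] -/
theorem tsig_sq (η : (𝓞 K)ˣ) : tsig (η ^ 2) = 1 := by
  rw [tsig, Units.val_pow_eq_pow_val, map_pow, ← pow_mul, show 2 * 31 = 62 by norm_num]
  exact pow_62_eq_one ((Units.isUnit η).map red4)

/-- `tsig (-1) = -1`. [folklore] -/
theorem tsig_neg_one : tsig (-1) = -1 := by
  rw [tsig, Units.val_neg, Units.val_one, map_neg, map_one]
  exact Odd.neg_one_pow (by decide)

/-- The classes `(σⁱ v mod 4)³¹`, `i < 5` (computed externally, verified below). [folklore] -/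
def vclsTab : Fin 5 → TAlg spec (ZMod 4) := ![⟨![3, 1, 3, 1, 3]⟩, ⟨![3, 3, 1, 3, 1]⟩, ⟨![1, 3, 3, 1, 3]⟩, ⟨![3, 1, 3, 3, 1]⟩, ⟨![1, 3, 1, 3, 3]⟩]

/-- `x³¹` by repeated squaring (for kernel evaluation). [folklore] -/
def pow31 (x : TAlg spec (ZMod 4)) : TAlg spec (ZMod 4) :=
  let x2 := x * x
  let x4 := x2 * x2
  let x8 := x4 * x4
  let x16 := x8 * x8
  x16 * x8 * x4 * x2 * x

/-- `pow31 x = x³¹`. [folklore] -/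
theorem pow31_eq (x : TAlg spec (ZMod 4)) : pow31 x = x ^ 31 := by
  simp only [pow31]; ring

set_option maxRecDepth 200000 in
set_option maxHeartbeats 0 in
/-- `(red 4 (shiftⁱ v))³¹ = vclsTab i` (kernel computation). [folklore] -/
theorem red_shift_iterate_vP_pow (i : Fin 5) : red 4 (shift^[(i : ℕ)] vP) ^ 31 = vclsTab i := by
  have h : ∀ i : Fin 5, pow31 (red 4 (shift^[(i : ℕ)] vP)) = vclsTab i := by decide +kernel
  rw [← pow31_eq]; exact h i

/-- **The class of the conjugate units.** [folklore] -/
theorem tsig_unitv (i : Fin 5) : tsig (unitv i) = vclsTab i := by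
  rw [tsig, coe_unitv, red4_liftO, red_shift_iterate_vP_pow]

/-- The predicted class of `rep n` (computable). [folklore] -/
def tsigOf (n : Fin 32) : TAlg spec (ZMod 4) :=
  (-1) ^ bit n 4 * (vclsTab 0 ^ bit n 0 * vclsTab 1 ^ bit n 1 * vclsTab 2 ^ bit n 2 * vclsTab 3 ^ bit n 3)

/-- **`tsig (rep n) = tsigOf n`.** [folklore] -/
theorem tsig_rep (n : Fin 32) : tsig (rep n) = tsigOf n := by
  rw [rep, ← tsigHom_apply, map_mul, map_pow, map_prod, tsigHom_apply, tsig_neg_one, tsigOf, Fin.prod_univ_four]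
  simp only [map_pow, tsigHom_apply, tsig_unitv, Fin.castSucc_zero, Fin.castSucc_one,
    show (Fin.castSucc (2 : Fin 4) : Fin 5) = 2 from rfl, show (Fin.castSucc (3 : Fin 4) : Fin 5) = 3 from rfl]

/-- The table of the `32` classes (computed externally, verified below). [folklore] -/
def tsigTab : Fin 32 → TAlg spec (ZMod 4) := ![⟨![1, 1, 1, 1, 1]⟩, ⟨![3, 1, 3, 1, 3]⟩, ⟨![3, 3, 1, 3, 1]⟩, ⟨![1, 3, 3, 3, 3]⟩, ⟨![1, 3, 3, 1, 3]⟩, ⟨![3, 3, 1, 1, 1]⟩, ⟨![3, 1, 3, 3, 3]⟩, ⟨![1, 1, 1, 3, 1]⟩, ⟨![3, 1, 3, 3, 1]⟩, ⟨![1, 1, 1, 3, 3]⟩, ⟨![1, 3, 3, 1, 1]⟩, ⟨![3, 3, 1, 1, 3]⟩, ⟨![3, 3, 1, 3, 3]⟩, ⟨![1, 3, 3, 3, 1]⟩, ⟨![1, 1, 1, 1, 3]⟩, ⟨![3, 1, 3, 1, 1]⟩, ⟨![3, 3, 3, 3, 3]⟩, ⟨![1, 3, 1, 3, 1]⟩,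 ⟨![1, 1, 3, 1, 3]⟩, ⟨![3, 1, 1, 1, 1]⟩, ⟨![3, 1, 1, 3, 1]⟩, ⟨![1, 1, 3, 3, 3]⟩, ⟨![1, 3, 1, 1, 1]⟩, ⟨![3, 3, 3, 1, 3]⟩, ⟨![1, 3, 1, 1, 3]⟩, ⟨![3, 3, 3, 1, 1]⟩, ⟨![3, 1, 1, 3, 3]⟩, ⟨![1, 1, 3, 3, 1]⟩, ⟨![1, 1, 3, 1, 1]⟩, ⟨![3, 1, 1, 1, 3]⟩, ⟨![3, 3, 3, 3, 1]⟩, ⟨![1, 3, 1, 3, 3]⟩]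

set_option maxRecDepth 400000 in
set_option maxHeartbeats 0 in
/-- `tsigOf = tsigTab` (kernel computation). [folklore] -/
theorem tsigOf_eq_tsigTab : ∀ n : Fin 32, tsigOf n = tsigTab n := by
  decide +kernel

set_option maxRecDepth 100000 in
set_option maxHeartbeats 0 in
/-- **The `32` classes are pairwise distinct** (kernel comparison of the table): the conjugates of `v`
and `-1` are independent modulo squares. [folklore] -/
theorem tsigOf_injective : Function.Injective tsigOf := by
  have h : ∀ n m : Fin 32, tsigTab n = tsigTab m → n = m := by decide +kernel
  intro n m hnm
  rw [tsigOf_eq_tsigTab, tsigOf_eq_tsigTab] at hnm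
  exact h n m hnm

/-- `tsigOf 0 = 1`. [folklore] -/
theorem tsigOf_zero : tsigOf 0 = 1 := by
  simp [tsigOf, bit]

/-! ### Units modulo squares (Dirichlet) -/

/-- For a quintic field the unit rank is at most `4`. [folklore] -/
theorem units_rank_le_four : Units.rank K ≤ 4 := by
  have h1 := InfinitePlace.card_add_two_mul_card_eq_rank K
  have h2 := InfinitePlace.card_eq_nrRealPlaces_add_nrComplexPlaces K
  rw [finrank_K] at h1
  rw [Units.rank, h2]
  omega

/-- **Units modulo squares (Dirichlet).** Every unit is `ρ(e) η²` with
`ρ(s, ε) = (-1)^s ∏ᵢ εᵢ^{εᵢ'}` over Mathlib's fundamental system. (Verbatim the tree's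
`CyclicQuintic241.exists_fund_rep_mul_sq`.) [folklore] -/
theorem exists_fund_rep_mul_sq (x : (𝓞 K)ˣ) :
    ∃ (s : Fin 2) (ε : Fin (Units.rank K) → Fin 2) (η : (𝓞 K)ˣ),
      x = ((-1) ^ (s : ℕ) * ∏ i, Units.fundSystem K i ^ ((ε i : ℕ))) * η ^ 2 := by
  classical
  obtain ⟨⟨ζ, e⟩, hx, -⟩ := Units.exist_unique_eq_mul_prod K x
  have hodd : Odd (Module.finrank ℚ K) := by rw [finrank_K]; decide
  refine ⟨if ((ζ : (𝓞 K)ˣ) = 1) then 0 else 1, fun i => ⟨(e i % 2).toNat, by omega⟩,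
    ∏ i, Units.fundSystem K i ^ (e i / 2), ?_⟩
  have hsplit : ∀ i, Units.fundSystem K i ^ e i =
      Units.fundSystem K i ^ (((⟨(e i % 2).toNat, by omega⟩ : Fin 2) : ℕ)) *
        (Units.fundSystem K i ^ (e i / 2)) ^ 2 := by
    intro i
    rw [← zpow_natCast, ← zpow_natCast (Units.fundSystem K i ^ (e i / 2)) 2, ← zpow_mul,
      ← zpow_add]
    congr 1
    push_cast
    rw [Int.toNat_of_nonneg (Int.emod_nonneg _ two_ne_zero)]
    omega
  rw [← Finset.prod_pow, mul_assoc, ← Finset.prod_mul_distrib]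
  simp_rw [← hsplit]
  rcases Units.torsion_eq_one_or_neg_one_of_odd_finrank hodd ζ with hζ | hζ
  · rw [if_pos hζ]
    simp only [Fin.val_zero, pow_zero, one_mul]
    rw [hζ, one_mul] at hx
    exact hx
  · have hne : (ζ : (𝓞 K)ˣ) ≠ 1 := by
      rw [hζ]
      intro h
      have h' := congrArg (fun u : (𝓞 K)ˣ => (u : 𝓞 K)) h
      simp only [Units.val_neg, Units.val_one] at h'
      norm_num at h'
    rw [if_neg hne]
    simp only [Fin.val_one, pow_one]
    rw [hζ] at hx
    exact hx

/-- **The class `tsig` classifies units modulo squares** (Dirichlet bound `32` versus `32` distinct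
classes). (The tree's `CyclicQuintic241.dsig_classifies` with `tsig` for `dsig`.) [folklore] -/
theorem tsig_classifies (x : (𝓞 K)ˣ) :
    (∃ n : Fin 32, tsig x = tsigOf n) ∧ (tsig x = 1 → ∃ η : (𝓞 K)ˣ, x = η ^ 2) := by
  classical
  set F := Units.fundSystem K with hF
  let E := Fin 2 × (Fin (Units.rank K) → Fin 2)
  let ρ' : E → (𝓞 K)ˣ := fun e => (-1) ^ (e.1 : ℕ) * ∏ i, F i ^ ((e.2 i : ℕ))
  have hρ0 : ρ' (0, fun _ => 0) = 1 := by simp [ρ']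
  have hcardE : Fintype.card E ≤ 32 := by
    have hr := units_rank_le_four
    simp only [E, Fintype.card_prod, Fintype.card_fun, Fintype.card_fin]
    calc 2 * 2 ^ Units.rank K ≤ 2 * 2 ^ 4 :=
          Nat.mul_le_mul_left 2 (Nat.pow_le_pow_right (by norm_num) hr)
      _ = 32 := by norm_num
  let T : Finset (TAlg spec (ZMod 4)) := Finset.univ.image tsigOf
  have hTcard : T.card = 32 := by
    rw [Finset.card_image_of_injective _ tsigOf_injective]
    simp
  have hred : ∀ y : (𝓞 K)ˣ, ∃ e : E, tsig y = tsig (ρ' e) := by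
    intro y
    obtain ⟨s, ε, η, hy⟩ := exists_fund_rep_mul_sq y
    exact ⟨(s, ε), by rw [hy, tsig_mul, tsig_sq, mul_one]⟩
  have hsurjT : T ⊆ Finset.univ.image (tsig ∘ ρ') := by
    intro w hw
    rw [Finset.mem_image] at hw ⊢
    obtain ⟨n, -, rfl⟩ := hw
    obtain ⟨e, he⟩ := hred (rep n)
    exact ⟨e, Finset.mem_univ e, by rw [Function.comp_apply, ← he, tsig_rep]⟩
  have hle : (Finset.univ.image (tsig ∘ ρ')).card ≤ T.card :=
    calc (Finset.univ.image (tsig ∘ ρ')).card ≤ (Finset.univ : Finset E).card := Finset.card_image_le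
      _ = Fintype.card E := Finset.card_univ
      _ ≤ 32 := hcardE
      _ = T.card := hTcard.symm
  have himage : T = Finset.univ.image (tsig ∘ ρ') := Finset.eq_of_subset_of_card_le hsurjT hle
  have hinj : Set.InjOn (tsig ∘ ρ') (Finset.univ : Finset E) := by
    rw [← Finset.card_image_iff]
    apply le_antisymm Finset.card_image_le
    calc (Finset.univ : Finset E).card = Fintype.card E := Finset.card_univ
      _ ≤ 32 := hcardE
      _ = T.card := hTcard.symm
      _ ≤ (Finset.univ.image (tsig ∘ ρ')).card := Finset.card_le_card hsurjT
  obtain ⟨s, ε, η, hxe⟩ := exists_fund_rep_mul_sq x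
  have hxsig : tsig x = tsig (ρ' (s, ε)) := by rw [hxe, tsig_mul, tsig_sq, mul_one]
  refine ⟨?_, fun hx => ?_⟩
  · have hmem : tsig x ∈ T := by
      rw [himage, Finset.mem_image]
      exact ⟨(s, ε), Finset.mem_univ _, hxsig.symm⟩
    obtain ⟨n, -, hn⟩ := Finset.mem_image.mp hmem
    exact ⟨n, hn.symm⟩
  · have hρe : (tsig ∘ ρ') (s, ε) = (tsig ∘ ρ') (0, fun _ => 0) := by
      rw [Function.comp_apply, Function.comp_apply, hρ0, tsig_one, ← hxsig, hx]
    have he0 : (s, ε) = (0, fun _ => 0) := hinj (Finset.mem_univ _) (Finset.mem_univ _) hρe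
    refine ⟨η, ?_⟩
    rw [hxe, show ((-1) ^ (s : ℕ) * ∏ i, F i ^ ((ε i : ℕ)) : (𝓞 K)ˣ) = ρ' (s, ε) from rfl, he0, hρ0,
      one_mul]

/-- **A unit of trivial `2`-adic class is a square.** [folklore] -/
theorem exists_sq_eq_of_tsig_eq_one (x : (𝓞 K)ˣ) (hx : tsig x = 1) : ∃ η : (𝓞 K)ˣ, x = η ^ 2 :=
  (tsig_classifies x).2 hx

/-- Group-theoretic bookkeeping: `x R = η²` gives `x = R (η R⁻¹)²`. [folklore] -/
theorem eq_mul_sq_of_mul_eq_sq' {G : Type*} [CommGroup G] {x r η : G} (h : x * r = η ^ 2) :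
    x = r * (η * r⁻¹) ^ 2 := by
  have e1 : x = η ^ 2 * r⁻¹ := eq_mul_inv_of_mul_eq h
  rw [e1, mul_pow, sq (r⁻¹), mul_left_comm r, mul_inv_cancel_left]

set_option maxRecDepth 100000 in
set_option maxHeartbeats 0 in
/-- Every class squares to `1`. [folklore] -/
theorem tsigOf_mul_self (n : Fin 32) : tsigOf n * tsigOf n = 1 := by
  have h : ∀ n : Fin 32, tsigTab n * tsigTab n = 1 := by decide +kernel
  rw [tsigOf_eq_tsigTab]; exact h n

/-- **Every unit of `K` is `rep n` times a square** (`n < 32`). [folklore] -/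
theorem exists_eq_rep_mul_sq (x : (𝓞 K)ˣ) : ∃ (n : Fin 32) (η : (𝓞 K)ˣ), x = rep n * η ^ 2 := by
  obtain ⟨n, hn⟩ := (tsig_classifies x).1
  have hsq : tsig (x * rep n) = 1 := by rw [tsig_mul, hn, tsig_rep, tsigOf_mul_self]
  obtain ⟨η, hη⟩ := exists_sq_eq_of_tsig_eq_one _ hsq
  exact ⟨n, η * (rep n)⁻¹, eq_mul_sq_of_mul_eq_sq' hη⟩

end CyclicQuintic2651K2

end Literature.NumberTheory.NumberFields

end
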